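import Literature.NumberTheory.Sieve.FriedlanderIwaniecPrimesJacobiTwistedBilinearBound
import HarnessLib

/-!
# Friedlander–Iwaniec, *The polynomial `X² + Y⁴` captures its primes*, §12: Proposition 11.1*

[FI, §12, Proposition 11.1* and its proof, pp. 45–46 of arXiv:math/9811185; Ann. of Math. 148 (1998)
945–1040].  PROPOSITION 11.1*: "Let `m, D, R, S ≥ 1`. For any complex numbers `α_{rs}` and `β_{rs}`
supported in the box (11.6) we have
`∑_{D<d≤2D} |∑∑_{r₁s₂≡r₂s₁ (mod dm), (r₁,r₂)=1} α_{r₁s₁} β̄_{r₂s₂} (d/(r₁r₂))| ≤ 𝓜(mD,R,S)‖α‖‖β‖`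
where `𝓜(D,R,S) ≪ D^{-1/2}RS log 2R + (D√(RS) + RS^{3/4} + SR^{3/4})(RS)^ε`."  Proof (printed): symbol
transfer `(d/(r₁r₂)) = (m/(r₁r₂))(ℓ/(r₁r₂))`, `ℓ = dm ∈ (mD, 2mD]` by positivity, Möbius removal of
`(r₁,r₂)=1`, Cauchy `L² ≤ L(α,α)L(β,β)`, Proposition 11.1 for each `ρ`, sum over `ρ`.

This file PROVES, on top of the core bound `exists_bilinearCongr_le` (file
`FriedlanderIwaniecPrimesJacobiTwistedBilinearBound`: everything in the printed proof except the Möbius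
step and the `ρ`-sum):

* `bilinearCoprime_eq_sum_moebius` — the Möbius step:
  `∑_{…, (r₁,r₂)=1} = ∑_{1≤ρ≤2R} μ(ρ) ∑_{…, ρ∣r₁, ρ∣r₂}`;
* `exists_prop111Star_tau` — **Proposition 11.1\* in the `τ`-weighted form**: for every `ε > 0`
  there is `C > 0` with
  `∑_{D<d≤2D} |∑_{r₁s₂≡r₂s₁ (dm), (r₁,r₂)=1} α β̄ (d/(r₁r₂))|`
  `≤ 4C {RS(mD)^{-1/2} + (mD√(RS) + RS^{3/4} + SR^{3/4})(RS)^ε} (∑ τ(r)|α_{rs}|²)^{1/2} (∑ τ(r)|β_{rs}|²)^{1/2}`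
  for all `m, D, R, S ≥ 1` and `α, β` supported on odd `r` coprime to `m` (the hypotheses the printed
  proof uses: "note that `(r₁r₂, m) = 1`", and (12.1)).  Route: the `ρ`-th Möbius term is the core form
  for the vectors `α 1_{ρ∣r}`, `β 1_{ρ∣r}`; Cauchy over `ρ` and `∑_{ρ≤2R} ∑_{ρ∣r} |α_{rs}|² = ∑ τ(r)|α_{rs}|²`.
  DEVIATION (recorded, cf. the tree's Prop. 13.1 `FriedlanderIwaniecPrimesJacobiTwistedProp131` and
  HOME/parity-ideate-lit/FI98-Prop121-MAP.md addendum (iv)): the printed `‖α‖‖β‖` with a `log 2R` in `𝓜`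
  is replaced by the divisor-weighted norms WITHOUT the `log 2R`; this is the currency of (12.17)/(12.3),
  which carry `∑ τ(r)|α_{rs}|²`.
* The printed substitution route (towards the plain-norm form) is also provided: `sum_Ioc_ite_dvd_eq`
  (multiples of `ρ` in `(A,B]`), `bilinearDvd_term_eq` / `bilinearDvd_eq_ite_coprime_mul` (the `ρ`-th
  term equals `[(d,ρ)=1]·T_ρ(d)`, `T_ρ` the core form for `r' ↦ α_{ρr's}` on `R/ρ < r' ≤ 2R/ρ`, using
  `(d/(ρ²r₁'r₂')) = (d/ρ)²(d/(r₁'r₂'))` and `(ρ, dm) = 1`), and `sum_norm_rhoTerm_le` (for `ρ ≤ R`,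
  `T_ρ` is bounded by the core bound on `(q, 4q]`, `q = ⌊R/ρ⌋`, via `exists_bilinearCongr_four_le`).

No definitions, no named facts.
-/

noncomputable section

open Finset Real Complex
open scoped NumberTheorySymbols ComplexConjugate ArithmeticFunction.Moebius

namespace Literature.NumberTheory.Sieve.FriedlanderIwaniecPrimes

/-! ### Möbius inversion of `(r₁, r₂) = 1` -/

/-- For `r₂ ∈ (R, 2R]`: `[(r₁, r₂) = 1] = ∑_{1 ≤ ρ ≤ 2R} μ(ρ) [ρ ∣ r₁] [ρ ∣ r₂]`. [folklore] -/
private theorem ite_coprime_eq_sum_Icc {R r₁ r₂ : ℕ} (hr₂ : r₂ ∈ Ioc R (2 * R)) :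
    (if r₁.Coprime r₂ then (1 : ℂ) else 0) =
      ∑ ρ ∈ Icc 1 (2 * R), if ρ ∣ r₁ ∧ ρ ∣ r₂ then (μ ρ : ℂ) else 0 := by
  rw [mem_Ioc] at hr₂
  have hr0 : r₂ ≠ 0 := by omega
  rw [ite_coprime_eq_sum_filter_moebius r₁ hr0, ← sum_filter]
  refine sum_congr ?_ fun _ _ => rfl
  ext ρ
  simp only [mem_filter, Nat.mem_divisors, mem_Icc]
  constructor
  · rintro ⟨⟨h2, -⟩, h1⟩
    exact ⟨⟨Nat.pos_of_dvd_of_pos h2 (by omega), (Nat.le_of_dvd (by omega) h2).trans hr₂.2⟩, h1, h2⟩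
  · rintro ⟨-, h1, h2⟩
    exact ⟨⟨h2, hr0⟩, h1⟩

/-- **Möbius inversion of the side condition `(r₁, r₂) = 1`** in the bilinear form of
Proposition 11.1* ("Then we remove the condition `(r₁, r₂) = 1` by Möbius inversion"):
`∑_{r₁s₂≡r₂s₁ (dm), (r₁,r₂)=1} α β̄ (d/(r₁r₂)) = ∑_{1≤ρ≤2R} μ(ρ) ∑_{ρ∣r₁, ρ∣r₂, r₁s₂≡r₂s₁ (dm)} α β̄ (d/(r₁r₂))`.
[cite: FriedlanderIwaniecAnnals1998, §12, proof of Proposition 11.1*] -/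
theorem bilinearCoprime_eq_sum_moebius (m d R S : ℕ) (α β : ℕ → ℕ → ℂ) :
    (∑ r₁ ∈ Ioc R (2 * R), ∑ s₁ ∈ Ioc S (2 * S), ∑ r₂ ∈ Ioc R (2 * R), ∑ s₂ ∈ Ioc S (2 * S),
      if ((d * m : ℕ) : ℤ) ∣ (r₁ : ℤ) * s₂ - (r₂ : ℤ) * s₁ ∧ r₁.Coprime r₂ then
        α r₁ s₁ * conj (β r₂ s₂) * (J((d : ℤ) | r₁ * r₂) : ℂ) else 0) =
    ∑ ρ ∈ Icc 1 (2 * R), (μ ρ : ℂ) *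
      ∑ r₁ ∈ Ioc R (2 * R), ∑ s₁ ∈ Ioc S (2 * S), ∑ r₂ ∈ Ioc R (2 * R), ∑ s₂ ∈ Ioc S (2 * S),
        if ρ ∣ r₁ ∧ ρ ∣ r₂ then
          (if ((d * m : ℕ) : ℤ) ∣ (r₁ : ℤ) * s₂ - (r₂ : ℤ) * s₁ then
            α r₁ s₁ * conj (β r₂ s₂) * (J((d : ℤ) | r₁ * r₂) : ℂ) else 0) else 0 := by
  -- termwise Möbius expansion
  have hterm : ∀ r₁ ∈ Ioc R (2 * R), ∀ s₁ ∈ Ioc S (2 * S), ∀ r₂ ∈ Ioc R (2 * R),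
      ∀ s₂ ∈ Ioc S (2 * S),
      (if ((d * m : ℕ) : ℤ) ∣ (r₁ : ℤ) * s₂ - (r₂ : ℤ) * s₁ ∧ r₁.Coprime r₂ then
        α r₁ s₁ * conj (β r₂ s₂) * (J((d : ℤ) | r₁ * r₂) : ℂ) else 0) =
      ∑ ρ ∈ Icc 1 (2 * R), (μ ρ : ℂ) *
        (if ρ ∣ r₁ ∧ ρ ∣ r₂ then
          (if ((d * m : ℕ) : ℤ) ∣ (r₁ : ℤ) * s₂ - (r₂ : ℤ) * s₁ then
            α r₁ s₁ * conj (β r₂ s₂) * (J((d : ℤ) | r₁ * r₂) : ℂ) else 0) else 0) := by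
    intro r₁ _ s₁ _ r₂ hr₂ s₂ _
    have key : (if ((d * m : ℕ) : ℤ) ∣ (r₁ : ℤ) * s₂ - (r₂ : ℤ) * s₁ ∧ r₁.Coprime r₂ then
        α r₁ s₁ * conj (β r₂ s₂) * (J((d : ℤ) | r₁ * r₂) : ℂ) else 0) =
        (if r₁.Coprime r₂ then (1 : ℂ) else 0) *
          (if ((d * m : ℕ) : ℤ) ∣ (r₁ : ℤ) * s₂ - (r₂ : ℤ) * s₁ then
            α r₁ s₁ * conj (β r₂ s₂) * (J((d : ℤ) | r₁ * r₂) : ℂ) else 0) := by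
      by_cases hc : r₁.Coprime r₂
      · rw [if_pos hc, one_mul]
        simp only [ite_and, if_pos hc]
      · rw [if_neg hc, zero_mul, if_neg (fun h => hc h.2)]
    rw [key, ite_coprime_eq_sum_Icc hr₂, sum_mul]
    refine sum_congr rfl fun ρ _ => ?_
    by_cases h : ρ ∣ r₁ ∧ ρ ∣ r₂ <;> simp [h]
  rw [sum_congr rfl fun r₁ hr₁ => sum_congr rfl fun s₁ hs₁ => sum_congr rfl fun r₂ hr₂ =>
    sum_congr rfl fun s₂ hs₂ => hterm r₁ hr₁ s₁ hs₁ r₂ hr₂ s₂ hs₂]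
  -- interchange the `ρ`-sum with the four outer sums
  simp only [Finset.sum_comm (t := Icc 1 (2 * R)), mul_sum]

/-! ### The substitution `r = ρ r'` -/

/-- The multiples of `ρ ≥ 1` in `(A, B]` are the `ρt`, `t ∈ (A/ρ, B/ρ]`:
`∑_{A<r≤B} [ρ ∣ r] F(r) = ∑_{A/ρ<t≤B/ρ} F(ρt)`. [folklore] -/
private theorem sum_Ioc_ite_dvd_eq {M : Type*} [AddCommMonoid M] {ρ : ℕ} (hρ : 0 < ρ) (A B : ℕ)
    (F : ℕ → M) :
    (∑ r ∈ Ioc A B, if ρ ∣ r then F r else 0) = ∑ t ∈ Ioc (A / ρ) (B / ρ), F (ρ * t) := by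
  rw [← sum_filter, filter_dvd_Ioc_eq_image hρ,
    sum_image fun x _ y _ h => Nat.eq_of_mul_eq_mul_left hρ h]

/-- An odd multiple `ρt` forces `ρ` and `t` odd and nonzero; coprimality to `m` descends to `ρ` and `t`.
[folklore] -/
private theorem odd_coprime_of_mul {ρ t m : ℕ} (ho : Odd (ρ * t)) (hc : (ρ * t).Coprime m) :
    Odd ρ ∧ Odd t ∧ ρ.Coprime m ∧ t.Coprime m :=
  ⟨(Nat.odd_mul.mp ho).1, (Nat.odd_mul.mp ho).2, Nat.Coprime.coprime_dvd_left (dvd_mul_right ρ t) hc,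
    Nat.Coprime.coprime_dvd_left (dvd_mul_left t ρ) hc⟩

/-- **The `ρ`-th term after the substitution `rᵢ = ρrᵢ'`** (termwise).  For `α, β` supported on odd
`r` coprime to `m`:
`[dm ∣ ρt₁s₂ − ρt₂s₁] α_{ρt₁,s₁} β̄_{ρt₂,s₂} (d/(ρt₁·ρt₂)) = [(d,ρ)=1] [dm ∣ t₁s₂ − t₂s₁] α_{ρt₁,s₁} β̄_{ρt₂,s₂} (d/(t₁t₂))`
("`(d/(ρ²r₁'r₂')) = (d/ρ)²(d/(r₁'r₂'))`"; the divisibility descends because `(ρ, dm) = 1`).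
[cite: FriedlanderIwaniecAnnals1998, §12, proof of Proposition 11.1*] -/
theorem bilinearDvd_term_eq {m d ρ : ℕ} {α β : ℕ → ℕ → ℂ}
    (hα : ∀ r s, α r s ≠ 0 → Odd r ∧ r.Coprime m) (hβ : ∀ r s, β r s ≠ 0 → Odd r ∧ r.Coprime m)
    (t₁ s₁ t₂ s₂ : ℕ) :
    (if ((d * m : ℕ) : ℤ) ∣ ((ρ * t₁ : ℕ) : ℤ) * s₂ - ((ρ * t₂ : ℕ) : ℤ) * s₁ then
        α (ρ * t₁) s₁ * conj (β (ρ * t₂) s₂) * (J((d : ℤ) | ρ * t₁ * (ρ * t₂)) : ℂ) else 0) =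
      if d.Coprime ρ then
        (if ((d * m : ℕ) : ℤ) ∣ (t₁ : ℤ) * s₂ - (t₂ : ℤ) * s₁ then
          α (ρ * t₁) s₁ * conj (β (ρ * t₂) s₂) * (J((d : ℤ) | t₁ * t₂) : ℂ) else 0) else 0 := by
  by_cases h1 : α (ρ * t₁) s₁ = 0
  · simp [h1]
  by_cases h2 : β (ρ * t₂) s₂ = 0
  · simp [h2]
  obtain ⟨hoρ, hot₁, hcρ, -⟩ := odd_coprime_of_mul (hα _ _ h1).1 (hα _ _ h1).2
  obtain ⟨-, hot₂, -, -⟩ := odd_coprime_of_mul (hβ _ _ h2).1 (hβ _ _ h2).2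
  have hρ0 : ρ ≠ 0 := by obtain ⟨k, hk⟩ := hoρ; omega
  have ht₁ : t₁ ≠ 0 := by obtain ⟨k, hk⟩ := hot₁; omega
  have ht₂ : t₂ ≠ 0 := by obtain ⟨k, hk⟩ := hot₂; omega
  -- `(d/(ρt₁·ρt₂)) = (d/ρ)² (d/(t₁t₂))`
  have hJ : J((d : ℤ) | ρ * t₁ * (ρ * t₂)) = J((d : ℤ) | ρ) ^ 2 * J((d : ℤ) | t₁ * t₂) := by
    rw [show ρ * t₁ * (ρ * t₂) = ρ * ρ * (t₁ * t₂) by ring,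
      jacobiSym.mul_right' _ (mul_ne_zero hρ0 hρ0) (mul_ne_zero ht₁ ht₂),
      jacobiSym.mul_right' _ hρ0 hρ0, sq]
  have hdet : ((ρ * t₁ : ℕ) : ℤ) * s₂ - ((ρ * t₂ : ℕ) : ℤ) * s₁ =
      (ρ : ℤ) * ((t₁ : ℤ) * s₂ - (t₂ : ℤ) * s₁) := by push_cast; ring
  by_cases hcop : d.Coprime ρ
  · rw [if_pos hcop]
    have hsq : J((d : ℤ) | ρ) ^ 2 = 1 :=
      jacobiSym.sq_one (by rw [Int.gcd_natCast_natCast]; exact hcop)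
    rw [hJ, hsq, one_mul, hdet]
    have hco : IsCoprime ((d * m : ℕ) : ℤ) (ρ : ℤ) := by
      rw [Int.isCoprime_iff_gcd_eq_one, Int.gcd_natCast_natCast]
      exact Nat.Coprime.mul_left hcop hcρ.symm
    have hiff : ((d * m : ℕ) : ℤ) ∣ (ρ : ℤ) * ((t₁ : ℤ) * s₂ - (t₂ : ℤ) * s₁) ↔
        ((d * m : ℕ) : ℤ) ∣ (t₁ : ℤ) * s₂ - (t₂ : ℤ) * s₁ :=
      ⟨fun h => hco.dvd_of_dvd_mul_left h, fun h => dvd_mul_of_dvd_right h _⟩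
    simp only [hiff]
  · rw [if_neg hcop]
    have hJ0 : J((d : ℤ) | ρ) = 0 := by
      rw [jacobiSym.eq_zero_iff]
      exact ⟨hρ0, by rw [Int.gcd_natCast_natCast]; exact hcop⟩
    rw [hJ, hJ0]
    simp

/-- **The `ρ`-th term of the Möbius expansion is `[(d,ρ)=1] · T_ρ(d)`**, with `T_ρ(d)` the bilinear
form of Proposition 11.1* for the vectors `r' ↦ α_{ρr's}`, `r' ↦ β_{ρr's}` on `R/ρ < r' ≤ 2R/ρ`
(modulus `dm`, symbol `(d/(r₁'r₂'))`), for `α, β` supported on odd `r` coprime to `m` and `ρ ≥ 1`.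
[cite: FriedlanderIwaniecAnnals1998, §12, proof of Proposition 11.1*] -/
theorem bilinearDvd_eq_ite_coprime_mul {m d ρ R S : ℕ} (hρ : 0 < ρ) {α β : ℕ → ℕ → ℂ}
    (hα : ∀ r s, α r s ≠ 0 → Odd r ∧ r.Coprime m) (hβ : ∀ r s, β r s ≠ 0 → Odd r ∧ r.Coprime m) :
    (∑ r₁ ∈ Ioc R (2 * R), ∑ s₁ ∈ Ioc S (2 * S), ∑ r₂ ∈ Ioc R (2 * R), ∑ s₂ ∈ Ioc S (2 * S),
      if ρ ∣ r₁ ∧ ρ ∣ r₂ then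
        (if ((d * m : ℕ) : ℤ) ∣ (r₁ : ℤ) * s₂ - (r₂ : ℤ) * s₁ then
          α r₁ s₁ * conj (β r₂ s₂) * (J((d : ℤ) | r₁ * r₂) : ℂ) else 0) else 0) =
    if d.Coprime ρ then
      ∑ t₁ ∈ Ioc (R / ρ) (2 * R / ρ), ∑ s₁ ∈ Ioc S (2 * S), ∑ t₂ ∈ Ioc (R / ρ) (2 * R / ρ),
        ∑ s₂ ∈ Ioc S (2 * S),
        (if ((d * m : ℕ) : ℤ) ∣ (t₁ : ℤ) * s₂ - (t₂ : ℤ) * s₁ then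
          α (ρ * t₁) s₁ * conj (β (ρ * t₂) s₂) * (J((d : ℤ) | t₁ * t₂) : ℂ) else 0)
    else 0 := by
  -- split the double indicator and substitute `r₁ = ρt₁`, `r₂ = ρt₂`
  have hsplit : ∀ r₁ s₁ r₂ s₂ : ℕ,
      (if ρ ∣ r₁ ∧ ρ ∣ r₂ then
        (if ((d * m : ℕ) : ℤ) ∣ (r₁ : ℤ) * s₂ - (r₂ : ℤ) * s₁ then
          α r₁ s₁ * conj (β r₂ s₂) * (J((d : ℤ) | r₁ * r₂) : ℂ) else 0) else 0) =
      if ρ ∣ r₁ then (if ρ ∣ r₂ then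
        (if ((d * m : ℕ) : ℤ) ∣ (r₁ : ℤ) * s₂ - (r₂ : ℤ) * s₁ then
          α r₁ s₁ * conj (β r₂ s₂) * (J((d : ℤ) | r₁ * r₂) : ℂ) else 0) else 0) else 0 := by
    intro r₁ s₁ r₂ s₂
    by_cases h1 : ρ ∣ r₁ <;> by_cases h2 : ρ ∣ r₂ <;> simp [h1, h2]
  simp_rw [hsplit]
  -- move the `r₁`-indicator out of the `s₁, r₂, s₂` sums and the `r₂`-indicator out of the `s₂` sum
  have hout : ∀ (c : Prop) [Decidable c] (T : Finset ℕ) (G : ℕ → ℂ),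
      (∑ x ∈ T, if c then G x else 0) = if c then ∑ x ∈ T, G x else 0 := by
    intro c _ T G
    split_ifs <;> simp
  simp_rw [hout]
  rw [sum_Ioc_ite_dvd_eq hρ]
  simp_rw [sum_Ioc_ite_dvd_eq hρ]
  -- termwise
  have hterm := fun t₁ s₁ t₂ s₂ => bilinearDvd_term_eq (d := d) (ρ := ρ) hα hβ t₁ s₁ t₂ s₂
  by_cases hcop : d.Coprime ρ
  · rw [if_pos hcop]
    exact sum_congr rfl fun t₁ _ => sum_congr rfl fun s₁ _ => sum_congr rfl fun t₂ _ =>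
      sum_congr rfl fun s₂ _ => by have h := hterm t₁ s₁ t₂ s₂; rw [if_pos hcop] at h; exact h
  · rw [if_neg hcop]
    exact sum_eq_zero fun t₁ _ => sum_eq_zero fun s₁ _ => sum_eq_zero fun t₂ _ =>
      sum_eq_zero fun s₂ _ => by have h := hterm t₁ s₁ t₂ s₂; rw [if_neg hcop] at h; exact h

/-! ### The `ρ`-th term for `ρ ≤ R`: the core bound on the range `R/ρ < r' ≤ 2R/ρ ⊆ (q, 4q]` -/

/-- For `q = ⌊R/ρ⌋ ≥ 1`: `⌊2R/ρ⌋ ≤ 4q`, so `(R/ρ, 2R/ρ] ⊆ (q, 4q]`. [folklore] -/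
private theorem Ioc_div_subset {R ρ : ℕ} (hρ : 0 < ρ) (hq : 1 ≤ R / ρ) :
    Ioc (R / ρ) (2 * R / ρ) ⊆ Ioc (R / ρ) (2 * (2 * (R / ρ))) := by
  intro t ht
  rw [mem_Ioc] at ht ⊢
  refine ⟨ht.1, ht.2.trans ?_⟩
  have h1 : R < ρ * (R / ρ + 1) := Nat.lt_mul_div_succ R hρ
  have h2 : 2 * R < (2 * (R / ρ) + 2) * ρ := by nlinarith [h1]
  have h3 : 2 * R / ρ < 2 * (R / ρ) + 2 := (Nat.div_lt_iff_lt_mul hρ).mpr h2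
  omega

set_option maxHeartbeats 800000 in
/-- **The `ρ`-th term, `ρ ≤ R`.**  With `T_ρ(d)` as in `bilinearDvd_eq_ite_coprime_mul` and
`q = ⌊R/ρ⌋ ≥ 1`, the core bound on the range `(q, 4q] ⊇ (R/ρ, 2R/ρ]` (hypothesis `h4` = the
conclusion of `exists_bilinearCongr_four_le` for the constant `C`) gives
`∑_{D<d≤2D} |T_ρ(d)| ≤ 8C(𝓜♭(mD,q,S) + 𝓜♭(mD,2q,S)) (∑_{R/ρ<r'≤2R/ρ} ∑_s |α_{ρr's}|²)^{1/2} (β likewise)^{1/2}`.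
[cite: FriedlanderIwaniecAnnals1998, §12, proof of Proposition 11.1*] -/
theorem sum_norm_rhoTerm_le {ε C : ℝ}
    (h4 : ∀ (m D R' S : ℕ) (α β : ℕ → ℕ → ℂ), 1 ≤ m → 1 ≤ D → 1 ≤ R' → 1 ≤ S →
      (∀ r s, α r s ≠ 0 → Odd r ∧ r.Coprime m) → (∀ r s, β r s ≠ 0 → Odd r ∧ r.Coprime m) →
      ∑ d ∈ Ioc D (2 * D), ‖∑ r₁ ∈ Ioc R' (2 * (2 * R')), ∑ s₁ ∈ Ioc S (2 * S),
          ∑ r₂ ∈ Ioc R' (2 * (2 * R')), ∑ s₂ ∈ Ioc S (2 * S),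
          (if ((d * m : ℕ) : ℤ) ∣ (r₁ : ℤ) * s₂ - (r₂ : ℤ) * s₁ then
            α r₁ s₁ * conj (β r₂ s₂) * (J((d : ℤ) | r₁ * r₂) : ℂ) else 0)‖ ≤
        8 * C * (((R' : ℝ) * S / Real.sqrt ((m : ℝ) * D) +
            ((m : ℝ) * D * Real.sqrt ((R' : ℝ) * S) + (R' : ℝ) * (S : ℝ) ^ (3 / 4 : ℝ) +
              (S : ℝ) * (R' : ℝ) ^ (3 / 4 : ℝ)) * ((R' : ℝ) * S) ^ ε) +
          (((2 * R' : ℕ) : ℝ) * S / Real.sqrt ((m : ℝ) * D) +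
            ((m : ℝ) * D * Real.sqrt (((2 * R' : ℕ) : ℝ) * S) +
              ((2 * R' : ℕ) : ℝ) * (S : ℝ) ^ (3 / 4 : ℝ) +
              (S : ℝ) * ((2 * R' : ℕ) : ℝ) ^ (3 / 4 : ℝ)) * (((2 * R' : ℕ) : ℝ) * S) ^ ε)) *
          (Real.sqrt (∑ r ∈ Ioc R' (2 * (2 * R')), ∑ s ∈ Ioc S (2 * S), ‖α r s‖ ^ 2) *
            Real.sqrt (∑ r ∈ Ioc R' (2 * (2 * R')), ∑ s ∈ Ioc S (2 * S), ‖β r s‖ ^ 2)))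
    {m D R S ρ : ℕ} (hm : 1 ≤ m) (hD : 1 ≤ D) (hS : 1 ≤ S) (hρ : 0 < ρ) (hq : 1 ≤ R / ρ)
    {α β : ℕ → ℕ → ℂ}
    (hα : ∀ r s, α r s ≠ 0 → Odd r ∧ r.Coprime m) (hβ : ∀ r s, β r s ≠ 0 → Odd r ∧ r.Coprime m) :
    ∑ d ∈ Ioc D (2 * D), ‖∑ t₁ ∈ Ioc (R / ρ) (2 * R / ρ), ∑ s₁ ∈ Ioc S (2 * S),
        ∑ t₂ ∈ Ioc (R / ρ) (2 * R / ρ), ∑ s₂ ∈ Ioc S (2 * S),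
        (if ((d * m : ℕ) : ℤ) ∣ (t₁ : ℤ) * s₂ - (t₂ : ℤ) * s₁ then
          α (ρ * t₁) s₁ * conj (β (ρ * t₂) s₂) * (J((d : ℤ) | t₁ * t₂) : ℂ) else 0)‖ ≤
      8 * C * ((((R / ρ : ℕ) : ℝ) * S / Real.sqrt ((m : ℝ) * D) +
          ((m : ℝ) * D * Real.sqrt (((R / ρ : ℕ) : ℝ) * S) +
            ((R / ρ : ℕ) : ℝ) * (S : ℝ) ^ (3 / 4 : ℝ) +
            (S : ℝ) * ((R / ρ : ℕ) : ℝ) ^ (3 / 4 : ℝ)) * (((R / ρ : ℕ) : ℝ) * S) ^ ε) +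
        (((2 * (R / ρ) : ℕ) : ℝ) * S / Real.sqrt ((m : ℝ) * D) +
          ((m : ℝ) * D * Real.sqrt (((2 * (R / ρ) : ℕ) : ℝ) * S) +
            ((2 * (R / ρ) : ℕ) : ℝ) * (S : ℝ) ^ (3 / 4 : ℝ) +
            (S : ℝ) * ((2 * (R / ρ) : ℕ) : ℝ) ^ (3 / 4 : ℝ)) * (((2 * (R / ρ) : ℕ) : ℝ) * S) ^ ε)) *
        (Real.sqrt (∑ t ∈ Ioc (R / ρ) (2 * R / ρ), ∑ s ∈ Ioc S (2 * S), ‖α (ρ * t) s‖ ^ 2) *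
          Real.sqrt (∑ t ∈ Ioc (R / ρ) (2 * R / ρ), ∑ s ∈ Ioc S (2 * S), ‖β (ρ * t) s‖ ^ 2)) := by
  classical
  have hsub : Ioc (R / ρ) (2 * R / ρ) ⊆ Ioc (R / ρ) (2 * (2 * (R / ρ))) := Ioc_div_subset hρ hq
  -- the restricted vectors
  set αρ : ℕ → ℕ → ℂ := fun r s => if r ∈ Ioc (R / ρ) (2 * R / ρ) then α (ρ * r) s else 0 with hαρ
  set βρ : ℕ → ℕ → ℂ := fun r s => if r ∈ Ioc (R / ρ) (2 * R / ρ) then β (ρ * r) s else 0 with hβρ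
  have hα0 : ∀ r s, r ∉ Ioc (R / ρ) (2 * R / ρ) → αρ r s = 0 := fun r s hr => by
    simp only [hαρ, if_neg hr]
  have hα1 : ∀ r s, r ∈ Ioc (R / ρ) (2 * R / ρ) → αρ r s = α (ρ * r) s := fun r s hr => by
    simp only [hαρ, if_pos hr]
  have hβ0 : ∀ r s, r ∉ Ioc (R / ρ) (2 * R / ρ) → βρ r s = 0 := fun r s hr => by
    simp only [hβρ, if_neg hr]
  have hβ1 : ∀ r s, r ∈ Ioc (R / ρ) (2 * R / ρ) → βρ r s = β (ρ * r) s := fun r s hr => by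
    simp only [hβρ, if_pos hr]
  have hsuppα : ∀ r s, αρ r s ≠ 0 → Odd r ∧ r.Coprime m := by
    intro r s h
    by_cases hr : r ∈ Ioc (R / ρ) (2 * R / ρ)
    · rw [hα1 r s hr] at h
      obtain ⟨-, ho, -, hc⟩ := odd_coprime_of_mul (hα _ _ h).1 (hα _ _ h).2
      exact ⟨ho, hc⟩
    · exact absurd (hα0 r s hr) h
  have hsuppβ : ∀ r s, βρ r s ≠ 0 → Odd r ∧ r.Coprime m := by
    intro r s h
    by_cases hr : r ∈ Ioc (R / ρ) (2 * R / ρ)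
    · rw [hβ1 r s hr] at h
      obtain ⟨-, ho, -, hc⟩ := odd_coprime_of_mul (hβ _ _ h).1 (hβ _ _ h).2
      exact ⟨ho, hc⟩
    · exact absurd (hβ0 r s hr) h
  have key := h4 m D (R / ρ) S αρ βρ hm hD hq hS hsuppα hsuppβ
  -- identify the inner sums
  have hinner : ∀ d : ℕ,
      (∑ t₁ ∈ Ioc (R / ρ) (2 * R / ρ), ∑ s₁ ∈ Ioc S (2 * S), ∑ t₂ ∈ Ioc (R / ρ) (2 * R / ρ),
        ∑ s₂ ∈ Ioc S (2 * S),
        (if ((d * m : ℕ) : ℤ) ∣ (t₁ : ℤ) * s₂ - (t₂ : ℤ) * s₁ then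
          α (ρ * t₁) s₁ * conj (β (ρ * t₂) s₂) * (J((d : ℤ) | t₁ * t₂) : ℂ) else 0)) =
      ∑ r₁ ∈ Ioc (R / ρ) (2 * (2 * (R / ρ))), ∑ s₁ ∈ Ioc S (2 * S),
        ∑ r₂ ∈ Ioc (R / ρ) (2 * (2 * (R / ρ))), ∑ s₂ ∈ Ioc S (2 * S),
        (if ((d * m : ℕ) : ℤ) ∣ (r₁ : ℤ) * s₂ - (r₂ : ℤ) * s₁ then
          αρ r₁ s₁ * conj (βρ r₂ s₂) * (J((d : ℤ) | r₁ * r₂) : ℂ) else 0) := by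
    intro d
    symm
    refine (sum_subset hsub fun r₁ _ hr₁ => ?_).symm.trans (sum_congr rfl fun r₁ hr₁ => ?_)
    · refine sum_eq_zero fun s₁ _ => sum_eq_zero fun r₂ _ => sum_eq_zero fun s₂ _ => ?_
      rw [hα0 r₁ s₁ hr₁]
      simp
    · refine sum_congr rfl fun s₁ _ => ?_
      refine (sum_subset hsub fun r₂ _ hr₂ => ?_).symm.trans (sum_congr rfl fun r₂ hr₂ => ?_)
      · refine sum_eq_zero fun s₂ _ => ?_
        rw [hβ0 r₂ s₂ hr₂]
        simp
      · refine sum_congr rfl fun s₂ _ => ?_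
        rw [hα1 r₁ s₁ hr₁, hβ1 r₂ s₂ hr₂]
  have hnormα : ∑ r ∈ Ioc (R / ρ) (2 * (2 * (R / ρ))), ∑ s ∈ Ioc S (2 * S), ‖αρ r s‖ ^ 2 =
      ∑ t ∈ Ioc (R / ρ) (2 * R / ρ), ∑ s ∈ Ioc S (2 * S), ‖α (ρ * t) s‖ ^ 2 := by
    refine (sum_subset hsub fun r _ hr => ?_).symm.trans (sum_congr rfl fun r hr => ?_)
    · exact sum_eq_zero fun s _ => by rw [hα0 r s hr]; simp
    · exact sum_congr rfl fun s _ => by rw [hα1 r s hr]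
  have hnormβ : ∑ r ∈ Ioc (R / ρ) (2 * (2 * (R / ρ))), ∑ s ∈ Ioc S (2 * S), ‖βρ r s‖ ^ 2 =
      ∑ t ∈ Ioc (R / ρ) (2 * R / ρ), ∑ s ∈ Ioc S (2 * S), ‖β (ρ * t) s‖ ^ 2 := by
    refine (sum_subset hsub fun r _ hr => ?_).symm.trans (sum_congr rfl fun r hr => ?_)
    · exact sum_eq_zero fun s _ => by rw [hβ0 r s hr]; simp
    · exact sum_congr rfl fun s _ => by rw [hβ1 r s hr]
  rw [hnormα, hnormβ] at key
  calc _ = _ := sum_congr rfl fun d _ => by rw [hinner d]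
    _ ≤ _ := key


/-! ### Proposition 11.1* in the `τ`-weighted form

Without the substitution `r = ρr'`: the `ρ`-th term of the Möbius expansion IS the core bilinear form for
the vectors `α 1_{ρ∣r}`, `β 1_{ρ∣r}` on the original box, so `exists_bilinearCongr_le` bounds it by
`4C 𝓜♭(mD,R,S) N_ρ(α)^{1/2} N_ρ(β)^{1/2}` with `N_ρ(α) = ∑_{ρ∣r} ∑_s |α_{rs}|²`; Cauchy's inequality over
`ρ` and `∑_{ρ≤2R} N_ρ(α) = ∑_r τ(r) ∑_s |α_{rs}|²` give Proposition 11.1* with `‖α‖‖β‖` replaced by the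
`τ`-weighted norms (and no `log 2R`).  This is the "`τ`-qualifier" form (as the tree states Prop. 13.1,
`FriedlanderIwaniecPrimesJacobiTwistedProp131`); it suffices for (12.17), whose right side carries
`∑ τ(r)|α_{rs}|²` anyway. -/

/-- Restricting the vectors to the multiples of `ρ`, termwise. [folklore] -/
private theorem ite_dvd_term_eq (ρ d m : ℕ) (α β : ℕ → ℕ → ℂ) (r₁ s₁ r₂ s₂ : ℕ) :
    (if ρ ∣ r₁ ∧ ρ ∣ r₂ then
      (if ((d * m : ℕ) : ℤ) ∣ (r₁ : ℤ) * s₂ - (r₂ : ℤ) * s₁ then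
        α r₁ s₁ * conj (β r₂ s₂) * (J((d : ℤ) | r₁ * r₂) : ℂ) else 0) else 0) =
    (if ((d * m : ℕ) : ℤ) ∣ (r₁ : ℤ) * s₂ - (r₂ : ℤ) * s₁ then
      (if ρ ∣ r₁ then α r₁ s₁ else 0) * conj (if ρ ∣ r₂ then β r₂ s₂ else 0) *
        (J((d : ℤ) | r₁ * r₂) : ℂ) else 0) := by
  by_cases h1 : ρ ∣ r₁ <;> by_cases h2 : ρ ∣ r₂ <;> simp [h1, h2]

/-- `∑_{1≤ρ≤2R} ∑_{R<r≤2R, ρ∣r} g(r) = ∑_{R<r≤2R} τ(r) g(r)`. [folklore] -/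
private theorem sum_Icc_sum_ite_dvd_eq (R : ℕ) (g : ℕ → ℝ) :
    ∑ ρ ∈ Icc 1 (2 * R), ∑ r ∈ Ioc R (2 * R), (if ρ ∣ r then g r else 0) =
      ∑ r ∈ Ioc R (2 * R), (ArithmeticFunction.sigma 0 r : ℝ) * g r := by
  rw [sum_comm]
  refine sum_congr rfl fun r hr => ?_
  rw [mem_Ioc] at hr
  have hset : (Icc 1 (2 * R)).filter (· ∣ r) = r.divisors := by
    ext ρ
    simp only [mem_filter, mem_Icc, Nat.mem_divisors]
    constructor
    · rintro ⟨-, h2⟩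
      exact ⟨h2, by omega⟩
    · rintro ⟨h2, -⟩
      exact ⟨⟨Nat.pos_of_dvd_of_pos h2 (by omega), (Nat.le_of_dvd (by omega) h2).trans hr.2⟩, h2⟩
  rw [← sum_filter, sum_const, nsmul_eq_mul, hset, ArithmeticFunction.sigma_zero_apply]

set_option maxHeartbeats 800000 in
/-- **Proposition 11.1* (τ-weighted form).**  For every `ε > 0` there is `C > 0` such that for all
`m, D, R, S ≥ 1` and all `α_{rs}, β_{rs}` on `R < r ≤ 2R`, `S < s ≤ 2S` supported on odd `r` coprime
to `m`,
`∑_{D<d≤2D} |∑_{r₁s₂ ≡ r₂s₁ (mod dm), (r₁,r₂)=1} α_{r₁s₁} β̄_{r₂s₂} (d/(r₁r₂))|`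
`≤ 4C {RS (mD)^{-1/2} + (mD√(RS) + RS^{3/4} + SR^{3/4})(RS)^ε} (∑ τ(r)|α_{rs}|²)^{1/2} (∑ τ(r)|β_{rs}|²)^{1/2}`.
Printed form: `≤ 𝓜(mD,R,S)‖α‖‖β‖`, `𝓜(D,R,S) ≪ D^{-1/2}RS log 2R + (D√(RS) + RS^{3/4} + SR^{3/4})(RS)^ε`;
here the `log 2R` (from `∑_ρ ρ^{-1}`) is traded for the divisor weights `τ(r)` in the norms (the form
in which (12.17) and Prop. 12.1 consume it), and the support hypotheses are those the printed proof uses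
("note that `(r₁r₂, m) = 1`"; (12.1)). [cite: FriedlanderIwaniecAnnals1998, Proposition 11.1*] -/
theorem exists_prop111Star_tau {ε : ℝ} (hε : 0 < ε) :
    ∃ C : ℝ, 0 < C ∧ ∀ (m D R S : ℕ) (α β : ℕ → ℕ → ℂ), 1 ≤ m → 1 ≤ D → 1 ≤ R → 1 ≤ S →
      (∀ r s, α r s ≠ 0 → Odd r ∧ r.Coprime m) → (∀ r s, β r s ≠ 0 → Odd r ∧ r.Coprime m) →
      ∑ d ∈ Ioc D (2 * D), ‖∑ r₁ ∈ Ioc R (2 * R), ∑ s₁ ∈ Ioc S (2 * S),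
          ∑ r₂ ∈ Ioc R (2 * R), ∑ s₂ ∈ Ioc S (2 * S),
          (if ((d * m : ℕ) : ℤ) ∣ (r₁ : ℤ) * s₂ - (r₂ : ℤ) * s₁ ∧ r₁.Coprime r₂ then
            α r₁ s₁ * conj (β r₂ s₂) * (J((d : ℤ) | r₁ * r₂) : ℂ) else 0)‖ ≤
        4 * C * ((R : ℝ) * S / Real.sqrt ((m : ℝ) * D) +
          ((m : ℝ) * D * Real.sqrt ((R : ℝ) * S) + (R : ℝ) * (S : ℝ) ^ (3 / 4 : ℝ) +
            (S : ℝ) * (R : ℝ) ^ (3 / 4 : ℝ)) * ((R : ℝ) * S) ^ ε) *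
          (Real.sqrt (∑ r ∈ Ioc R (2 * R), ∑ s ∈ Ioc S (2 * S),
              (ArithmeticFunction.sigma 0 r : ℝ) * ‖α r s‖ ^ 2) *
            Real.sqrt (∑ r ∈ Ioc R (2 * R), ∑ s ∈ Ioc S (2 * S),
              (ArithmeticFunction.sigma 0 r : ℝ) * ‖β r s‖ ^ 2)) := by
  obtain ⟨C, hC, hflat⟩ := exists_bilinearCongr_le hε
  refine ⟨C, hC, fun m D R S α β hm hD hR hS hα hβ => ?_⟩
  set M : ℝ := (R : ℝ) * S / Real.sqrt ((m : ℝ) * D) +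
    ((m : ℝ) * D * Real.sqrt ((R : ℝ) * S) + (R : ℝ) * (S : ℝ) ^ (3 / 4 : ℝ) +
      (S : ℝ) * (R : ℝ) ^ (3 / 4 : ℝ)) * ((R : ℝ) * S) ^ ε with hM
  have hM0 : 0 ≤ 4 * C * M := by positivity
  -- the `ρ`-restricted vectors and their norms
  have hsupp : ∀ (x : ℕ → ℕ → ℂ) (ρ : ℕ), (∀ r s, x r s ≠ 0 → Odd r ∧ r.Coprime m) →
      ∀ r s, (if ρ ∣ r then x r s else 0) ≠ 0 → Odd r ∧ r.Coprime m := by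
    intro x ρ hx r s h
    by_cases hr : ρ ∣ r
    · rw [if_pos hr] at h; exact hx r s h
    · rw [if_neg hr] at h; exact absurd rfl h
  have hnorm : ∀ (x : ℕ → ℕ → ℂ) (ρ : ℕ),
      ∑ r ∈ Ioc R (2 * R), ∑ s ∈ Ioc S (2 * S), ‖(if ρ ∣ r then x r s else 0)‖ ^ 2 =
        ∑ r ∈ Ioc R (2 * R), (if ρ ∣ r then ∑ s ∈ Ioc S (2 * S), ‖x r s‖ ^ 2 else 0) := by
    intro x ρ
    refine sum_congr rfl fun r _ => ?_
    by_cases hr : ρ ∣ r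
    · simp only [if_pos hr]
    · simp [if_neg hr]
  -- Step 1: Möbius, triangle inequality, `|μ| ≤ 1`, and the core bound for each `ρ`
  have hρ : ∀ ρ ∈ Icc 1 (2 * R), ∑ d ∈ Ioc D (2 * D),
      ‖(μ ρ : ℂ) * ∑ r₁ ∈ Ioc R (2 * R), ∑ s₁ ∈ Ioc S (2 * S), ∑ r₂ ∈ Ioc R (2 * R),
        ∑ s₂ ∈ Ioc S (2 * S),
        (if ρ ∣ r₁ ∧ ρ ∣ r₂ then
          (if ((d * m : ℕ) : ℤ) ∣ (r₁ : ℤ) * s₂ - (r₂ : ℤ) * s₁ then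
            α r₁ s₁ * conj (β r₂ s₂) * (J((d : ℤ) | r₁ * r₂) : ℂ) else 0) else 0)‖ ≤
      4 * C * M *
        (Real.sqrt (∑ r ∈ Ioc R (2 * R), if ρ ∣ r then ∑ s ∈ Ioc S (2 * S), ‖α r s‖ ^ 2 else 0) *
          Real.sqrt (∑ r ∈ Ioc R (2 * R), if ρ ∣ r then ∑ s ∈ Ioc S (2 * S), ‖β r s‖ ^ 2 else 0)) := by
    intro ρ _
    have key := hflat m D R S (fun r s => if ρ ∣ r then α r s else 0)
      (fun r s => if ρ ∣ r then β r s else 0) hm hD hR hS (hsupp α ρ hα) (hsupp β ρ hβ)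
    rw [hnorm α ρ, hnorm β ρ, ← hM] at key
    refine le_trans (sum_le_sum fun d _ => ?_) key
    rw [norm_mul]
    have hμ : ‖(μ ρ : ℂ)‖ ≤ 1 := by
      rw [Complex.norm_intCast]
      exact_mod_cast ArithmeticFunction.abs_moebius_le_one
    have heq : (∑ r₁ ∈ Ioc R (2 * R), ∑ s₁ ∈ Ioc S (2 * S), ∑ r₂ ∈ Ioc R (2 * R),
        ∑ s₂ ∈ Ioc S (2 * S),
        (if ρ ∣ r₁ ∧ ρ ∣ r₂ then
          (if ((d * m : ℕ) : ℤ) ∣ (r₁ : ℤ) * s₂ - (r₂ : ℤ) * s₁ then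
            α r₁ s₁ * conj (β r₂ s₂) * (J((d : ℤ) | r₁ * r₂) : ℂ) else 0) else 0)) =
        ∑ r₁ ∈ Ioc R (2 * R), ∑ s₁ ∈ Ioc S (2 * S), ∑ r₂ ∈ Ioc R (2 * R), ∑ s₂ ∈ Ioc S (2 * S),
        (if ((d * m : ℕ) : ℤ) ∣ (r₁ : ℤ) * s₂ - (r₂ : ℤ) * s₁ then
          (fun r s => if ρ ∣ r then α r s else 0) r₁ s₁ *
            conj ((fun r s => if ρ ∣ r then β r s else 0) r₂ s₂) *
            (J((d : ℤ) | r₁ * r₂) : ℂ) else 0) :=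
      sum_congr rfl fun r₁ _ => sum_congr rfl fun s₁ _ => sum_congr rfl fun r₂ _ =>
        sum_congr rfl fun s₂ _ => ite_dvd_term_eq ρ d m α β r₁ s₁ r₂ s₂
    rw [heq]
    exact mul_le_of_le_one_left (norm_nonneg _) hμ
  -- Step 2: sum over `ρ`, Cauchy's inequality, and the `τ` identity
  have hτα := sum_Icc_sum_ite_dvd_eq R (fun r => ∑ s ∈ Ioc S (2 * S), ‖α r s‖ ^ 2)
  have hτβ := sum_Icc_sum_ite_dvd_eq R (fun r => ∑ s ∈ Ioc S (2 * S), ‖β r s‖ ^ 2)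
  simp only [mul_sum] at hτα hτβ
  calc ∑ d ∈ Ioc D (2 * D), ‖∑ r₁ ∈ Ioc R (2 * R), ∑ s₁ ∈ Ioc S (2 * S),
          ∑ r₂ ∈ Ioc R (2 * R), ∑ s₂ ∈ Ioc S (2 * S),
          (if ((d * m : ℕ) : ℤ) ∣ (r₁ : ℤ) * s₂ - (r₂ : ℤ) * s₁ ∧ r₁.Coprime r₂ then
            α r₁ s₁ * conj (β r₂ s₂) * (J((d : ℤ) | r₁ * r₂) : ℂ) else 0)‖
      = ∑ d ∈ Ioc D (2 * D), ‖∑ ρ ∈ Icc 1 (2 * R), (μ ρ : ℂ) *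
          ∑ r₁ ∈ Ioc R (2 * R), ∑ s₁ ∈ Ioc S (2 * S), ∑ r₂ ∈ Ioc R (2 * R), ∑ s₂ ∈ Ioc S (2 * S),
          (if ρ ∣ r₁ ∧ ρ ∣ r₂ then
            (if ((d * m : ℕ) : ℤ) ∣ (r₁ : ℤ) * s₂ - (r₂ : ℤ) * s₁ then
              α r₁ s₁ * conj (β r₂ s₂) * (J((d : ℤ) | r₁ * r₂) : ℂ) else 0) else 0)‖ :=
        sum_congr rfl fun d _ => by rw [bilinearCoprime_eq_sum_moebius]
    _ ≤ ∑ d ∈ Ioc D (2 * D), ∑ ρ ∈ Icc 1 (2 * R), ‖(μ ρ : ℂ) *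
          ∑ r₁ ∈ Ioc R (2 * R), ∑ s₁ ∈ Ioc S (2 * S), ∑ r₂ ∈ Ioc R (2 * R), ∑ s₂ ∈ Ioc S (2 * S),
          (if ρ ∣ r₁ ∧ ρ ∣ r₂ then
            (if ((d * m : ℕ) : ℤ) ∣ (r₁ : ℤ) * s₂ - (r₂ : ℤ) * s₁ then
              α r₁ s₁ * conj (β r₂ s₂) * (J((d : ℤ) | r₁ * r₂) : ℂ) else 0) else 0)‖ :=
        sum_le_sum fun d _ => norm_sum_le _ _
    _ = ∑ ρ ∈ Icc 1 (2 * R), ∑ d ∈ Ioc D (2 * D), ‖(μ ρ : ℂ) *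
          ∑ r₁ ∈ Ioc R (2 * R), ∑ s₁ ∈ Ioc S (2 * S), ∑ r₂ ∈ Ioc R (2 * R), ∑ s₂ ∈ Ioc S (2 * S),
          (if ρ ∣ r₁ ∧ ρ ∣ r₂ then
            (if ((d * m : ℕ) : ℤ) ∣ (r₁ : ℤ) * s₂ - (r₂ : ℤ) * s₁ then
              α r₁ s₁ * conj (β r₂ s₂) * (J((d : ℤ) | r₁ * r₂) : ℂ) else 0) else 0)‖ := sum_comm
    _ ≤ ∑ ρ ∈ Icc 1 (2 * R), 4 * C * M *
          (Real.sqrt (∑ r ∈ Ioc R (2 * R), if ρ ∣ r then ∑ s ∈ Ioc S (2 * S), ‖α r s‖ ^ 2 else 0) *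
            Real.sqrt (∑ r ∈ Ioc R (2 * R),
              if ρ ∣ r then ∑ s ∈ Ioc S (2 * S), ‖β r s‖ ^ 2 else 0)) := sum_le_sum hρ
    _ = 4 * C * M * ∑ ρ ∈ Icc 1 (2 * R),
          Real.sqrt (∑ r ∈ Ioc R (2 * R), if ρ ∣ r then ∑ s ∈ Ioc S (2 * S), ‖α r s‖ ^ 2 else 0) *
            Real.sqrt (∑ r ∈ Ioc R (2 * R),
              if ρ ∣ r then ∑ s ∈ Ioc S (2 * S), ‖β r s‖ ^ 2 else 0) := by rw [mul_sum]
    _ ≤ 4 * C * M * (Real.sqrt (∑ ρ ∈ Icc 1 (2 * R), ∑ r ∈ Ioc R (2 * R),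
            if ρ ∣ r then ∑ s ∈ Ioc S (2 * S), ‖α r s‖ ^ 2 else 0) *
          Real.sqrt (∑ ρ ∈ Icc 1 (2 * R), ∑ r ∈ Ioc R (2 * R),
            if ρ ∣ r then ∑ s ∈ Ioc S (2 * S), ‖β r s‖ ^ 2 else 0)) := by
        gcongr
        exact Real.sum_sqrt_mul_sqrt_le _
          (fun ρ => sum_nonneg fun r _ => by split_ifs <;> positivity)
          (fun ρ => sum_nonneg fun r _ => by split_ifs <;> positivity)
    _ = _ := by rw [hτα, hτβ]


end Literature.NumberTheory.Sieve.FriedlanderIwaniecPrimes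

end
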